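import Summits.NavierStokesRegularity.NavierStokesRegularity.Theses.CorkscrewDynamo
import Summits.NavierStokesRegularity.NavierStokesRegularity.Theses.QuarterTurnRdss

/-!
# Route CorkscrewDynamo · crux `CorkscrewProfile` (stmt-NavierStokesRegularity-11282) — a quarter-turn RDSS profile is a corkscrew

`corkscrewProfile_of_quarterTurnProfileExists : QuarterTurnRdss.QuarterTurnProfileExists → CorkscrewDynamo.CorkscrewProfile`
(registered tools stub `stub_corkscrewProfileOfQuarterTurnProfileExists` of the line `birth`, lead c2).

The crux `QuarterTurnProfileExists` of route `QuarterTurnRdss` (stmt-NavierStokesRegularity-1100: a nontrivial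
Type-I ancient mild solution, rotated `c`-DSS with the quarter turn `R` about `e₃`, GENUINELY TWISTED — not every
slice is a.e. `R`-equivariant) is a corkscrew with `θ = π/2`: the quarter turn is the rotation by `π/2` pinned by
coordinates (`cos(π/2) = 0`, `sin(π/2) = 1`), and by rotated self-similarity `c u(c²t, c·) = R u(t, R⁻¹·)`
exactly, so plain `c`-DSS a.e. on a slice is a.e. `R`-equivariance of that slice (composition with the
measure-preserving `R`). Hence stmt-1100, like `FilamentSkeletonRss.RssProfileExists` (stmt-16274), closes this
crux in one line.
-/

noncomputable section

open Set Function MeasureTheory Literature.Analysis.FluidPDE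

namespace Summit.NavierStokesRegularity.NavierStokesRegularity.Theorems.CorkscrewProfile.Birth

set_option linter.dupNamespace false

/-- **Plain rescaling of a rotated-DSS field is conjugation by the rotation**: if
`c R⁻¹ u(c²t, cRx) = u(t,x)` then `c u(c²t, c z) = R u(t, R⁻¹ z)`, i.e. `nsRescale c u t = R ∘ u t ∘ R⁻¹`. -/
theorem nsRescale_eq_conj_of_isRotatedDSS {c : ℝ}
    {R : EuclideanSpace ℝ (Fin 3) ≃ₗᵢ[ℝ] EuclideanSpace ℝ (Fin 3)}
    {u : ℝ → EuclideanSpace ℝ (Fin 3) → EuclideanSpace ℝ (Fin 3)} (h : IsRotatedDSS c R u) (t : ℝ) :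
    nsRescale c u t = fun z => R (u t (R.symm z)) := by
  funext z
  rw [nsRescale_apply]
  have key := h t (R.symm z)
  rw [LinearIsometryEquiv.apply_symm_apply] at key
  have key2 := congrArg (⇑R) key
  rw [map_smul, LinearIsometryEquiv.apply_symm_apply] at key2
  exact key2

/-- **Registered tools stub `stub_corkscrewProfileOfQuarterTurnProfileExists` — a genuinely twisted quarter-turn
RDSS profile is a corkscrew.** `QuarterTurnRdss.QuarterTurnProfileExists` (stmt-NavierStokesRegularity-1100)
implies `CorkscrewDynamo.CorkscrewProfile` with the same `(c, R, u)` and `θ = π/2`. -/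
theorem stub_corkscrewProfileOfQuarterTurnProfileExists :
    Summit.NavierStokesRegularity.NavierStokesRegularity.Theses.QuarterTurnRdss.QuarterTurnProfileExists →
      Summit.NavierStokesRegularity.NavierStokesRegularity.Theses.CorkscrewDynamo.CorkscrewProfile := by
  rintro ⟨c, hc, R, hR, u, hmild, hmeas, hrdss, hC, hnz, htwist⟩
  refine ⟨c, Real.pi / 2, R, u, hc, fun x => ?_, hmild, hmeas, hrdss, hC, ?_, hnz⟩
  · obtain ⟨h0, h1, h2⟩ := hR x
    rw [Real.cos_pi_div_two, Real.sin_pi_div_two, h0, h1, h2]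
    refine ⟨by ring, by ring, rfl⟩
  · intro hall
    apply htwist
    intro t ht
    have hae := hall t ht
    rw [nsRescale_eq_conj_of_isRotatedDSS hrdss t] at hae
    have h2 : (fun z => R (u t (R.symm z))) ∘ (⇑R) =ᵐ[volume] u t ∘ (⇑R) :=
      (R.measurePreserving.quasiMeasurePreserving (μa := volume) (μb := volume)).ae_eq_comp hae
    have h3 : (fun x => R (u t x)) =ᵐ[volume] fun x => u t (R x) := by
      filter_upwards [h2] with x hx
      simpa [Function.comp, LinearIsometryEquiv.symm_apply_apply] using hx
    exact h3.symm

/-- **A quarter-turn RDSS profile is a corkscrew** (named form of the registered stub). -/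
theorem corkscrewProfile_of_quarterTurnProfileExists
    (h : Summit.NavierStokesRegularity.NavierStokesRegularity.Theses.QuarterTurnRdss.QuarterTurnProfileExists) :
    Summit.NavierStokesRegularity.NavierStokesRegularity.Theses.CorkscrewDynamo.CorkscrewProfile :=
  stub_corkscrewProfileOfQuarterTurnProfileExists h

end Summit.NavierStokesRegularity.NavierStokesRegularity.Theorems.CorkscrewProfile.Birth
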